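import Summits.CriticalPhenomena.PercolationContinuityZ3.Theorems.TransplantHeisenbergZ
import Summits.CriticalPhenomena.PercolationContinuityZ3.Theorems.TransplantHeisenbergZConnected
import Literature.Probability.Percolation.CoveringStrictMonotonicityHolds
import Literature.Probability.Percolation.CoveringQuotientMap
import HarnessLib

/-!
# (D5) on `H₃(ℤ) × ℤ`: no slab percolates at `p_c` — via Martineau–Severo's central quotient

Builds on p205010 (kernel theorem, internal audit signed; external expert review pending).  Lane
`prim-bschramm`, rung R3a (memo `run/shared/lean/prim/bschramm/P3-NILPOTENT.md` §4.0; LADDER R3a / VERDICT V11).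

Let `G = Cay(H₃(ℤ) × ℤ, {A^±,B^±,T^±})` and `Γ_M = ⟨C^M⟩` (`C = [A,B]` central) acting by
`(a,b,c,t) ↦ (a,b,c+Mn,t)`.  The action is free, by graph automorphisms, with quasi-transitive quotient
(left translations commute with `Γ_M` and descend: `quotIsoOfEquivariant`, a general descent lemma), and
`G` is connected, quasi-transitive with `p_c(G) < 1` (p207485, p207690); so Martineau–Severo's
Corollary 2.2 — the tree's theorem `MartineauSevero2019_cor22_holds` — gives
`p_c(G) < p_c(Γ_M \\ G)` (`criticalProb_lt_criticalProb_centralQuotient`).  For `M > 2r² + r` the slab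
`S_r = {|b| ≤ r, |c − ab| ≤ r²}` meets every `Γ_M`-orbit at most once and no edge of `G` joins `S_r` to a
non-trivial `Γ_M`-translate of `S_r` (the slab coordinate `c − ab` moves by at most `|b| ≤ r` along an
edge), so `G[S_r]` IS the pull-back of the quotient graph (`hzSlabGraph_eq_comap`) and the restriction
coupling `theta_comap_le` gives `p_c(Γ_M \\ G) ≤ p_c(S_r)`.  Hence:

* `heisenbergZSlabStrictSubcritical_holds : HeisenbergZSlabStrictSubcritical` — `p_c(G) < p_c(S_r)` ∀ r;
* `heisenbergZSlabCritical_holds : HeisenbergZSlabCritical` — `θ_{S_r}(p_c(G)) = 0` ∀ r ((D5) of the rung);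
* `continuity_of_slabPercolation : HeisenbergZSlabPercolation → HeisenbergZCriticalContinuity` — on this
  rung `θ(p_c) = 0` is EXACTLY the same-`p` slab statement (KN §4 analogue), nothing else.

Pattern: `L/QuotientStrictMonotonicity*.lean` (`ℤ³ → C_n □ ℤ²`), here with the GENERAL Cor. 2.2 instead of
a bespoke re-run of its proof. [cite: MartineauSevero2019, Cor. 2.2] [cite: KozmaNitzan2024, Thm. 6]
-/

noncomputable section

namespace Summit.CriticalPhenomena.PercolationContinuityZ3.Theorems.HeisenbergZ

open MeasureTheory Literature.Probability.Percolation Literature.Probability.LatticeModels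
open Literature.Barriers.CriticalPhenomena (IsGraphTransitive IsQuasiTransitive)

section CentralQuotient

open Literature.Probability.Percolation (orbitQuotientGraph qmk IsActionByAut quot_adj_iff qmk_eq_iff)

/-- The group `Γ_M ≅ ℤ` of central translations `x ↦ C^{Mn}·x` (a type synonym of `Multiplicative ℤ`,
so that its action on `Fin 4 → ℤ` does not pollute the instance table). [folklore] -/
def CentralShift (_M : ℕ) : Type := Multiplicative ℤ

/-- `Γ_M` is a group (that of `Multiplicative ℤ`). [folklore] -/
instance (M : ℕ) : Group (CentralShift M) := inferInstanceAs (Group (Multiplicative ℤ))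
/-- `Γ_M` is non-trivial. [folklore] -/
instance (M : ℕ) : Nontrivial (CentralShift M) := inferInstanceAs (Nontrivial (Multiplicative ℤ))

/-- The exponent `n` of `g = C^{Mn}`. [folklore] -/
def CentralShift.exp {M : ℕ} (g : CentralShift M) : ℤ := Multiplicative.toAdd (show Multiplicative ℤ from g)

/-- `exp 1 = 0`. [folklore] -/
@[simp] theorem CentralShift.exp_one {M : ℕ} : (1 : CentralShift M).exp = 0 := rfl
/-- `exp (g h) = exp g + exp h`. [folklore] -/
@[simp] theorem CentralShift.exp_mul {M : ℕ} (g h : CentralShift M) : (g * h).exp = g.exp + h.exp := rfl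
/-- `exp` is injective. [folklore] -/
theorem CentralShift.exp_injective {M : ℕ} : Function.Injective (CentralShift.exp (M := M)) :=
  fun _ _ h => Multiplicative.toAdd.injective h

/-- `C^{Mn} · x = (a, b, c + Mn, t)` (left = right multiplication by a central element). [folklore] -/
instance (M : ℕ) : MulAction (CentralShift M) HZ where
  smul g x := ![x 0, x 1, x 2 + M * g.exp, x 3]
  one_smul x := by
    show (![x 0, x 1, x 2 + M * (1 : CentralShift M).exp, x 3] : HZ) = x
    ext i; fin_cases i <;> simp
  mul_smul g h x := by
    show (![x 0, x 1, x 2 + M * (g * h).exp, x 3] : HZ) =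
      ![(![x 0, x 1, x 2 + M * h.exp, x 3] : HZ) 0, (![x 0, x 1, x 2 + M * h.exp, x 3] : HZ) 1,
        (![x 0, x 1, x 2 + M * h.exp, x 3] : HZ) 2 + M * g.exp, (![x 0, x 1, x 2 + M * h.exp, x 3] : HZ) 3]
    ext i; fin_cases i <;> simp; ring

/-- The action, unfolded. [folklore] -/
theorem CentralShift.smul_def {M : ℕ} (g : CentralShift M) (x : HZ) :
    g • x = ![x 0, x 1, x 2 + M * g.exp, x 3] := rfl

/-- The action is left multiplication by the central element `(0,0,Mn,0)`. [folklore] -/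
theorem CentralShift.smul_eq_hzMul {M : ℕ} (g : CentralShift M) (x : HZ) :
    g • x = hzMul ![0, 0, M * g.exp, 0] x := by
  rw [CentralShift.smul_def]; ext i; fin_cases i <;> simp [hzMul]; ring

/-- The action is by graph automorphisms. [folklore] -/
theorem centralShift_isActionByAut (M : ℕ) : IsActionByAut heisenbergZGraph (CentralShift M) := by
  intro g x y
  rw [CentralShift.smul_eq_hzMul, CentralShift.smul_eq_hzMul]
  exact (hzLeftIso _).map_rel_iff'

/-- The action is free (for `M ≠ 0`). [folklore] -/
theorem centralShift_free {M : ℕ} (hM : M ≠ 0) (g : CentralShift M) (x : HZ) (h : g • x = x) : g = 1 := by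
  have h2 := congrFun h 2
  rw [CentralShift.smul_def] at h2
  simp only [Matrix.cons_val] at h2
  have : (M : ℤ) * g.exp = 0 := by linarith
  have hexp : g.exp = 0 := by
    rcases mul_eq_zero.1 this with h | h
    · exact absurd (by exact_mod_cast h) hM
    · exact h
  exact CentralShift.exp_injective (by simpa using hexp)

/-- Left translations commute with the central action. [folklore] -/
theorem hzMul_smul {M : ℕ} (g : CentralShift M) (h x : HZ) : hzMul h (g • x) = g • hzMul h x := by
  rw [CentralShift.smul_def, CentralShift.smul_def]
  ext i; fin_cases i <;> simp [hzMul]; ring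

/-- A `Γ`-EQUIVARIANT automorphism of a graph descends to an automorphism of the orbit quotient graph.
(General; stated for any action by automorphisms.) [folklore] -/
def quotIsoOfEquivariant {V : Type*} {G : SimpleGraph V} {Γ : Type*} [Group Γ] [MulAction Γ V]
    (hact : IsActionByAut G Γ) (φ : G ≃g G) (hφ : ∀ (g : Γ) (x : V), φ (g • x) = g • φ x) :
    orbitQuotientGraph G Γ ≃g orbitQuotientGraph G Γ :=
  have hφ' : ∀ (g : Γ) (x : V), φ.symm (g • x) = g • φ.symm x := fun g x => by
    apply φ.injective
    rw [RelIso.apply_symm_apply, hφ, RelIso.apply_symm_apply]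
  { toFun := Quotient.map' φ fun a b hab => by
      obtain ⟨g, rfl⟩ := MulAction.orbitRel_apply.1 hab
      exact MulAction.orbitRel_apply.2 ⟨g, (hφ g b).symm⟩
    invFun := Quotient.map' φ.symm fun a b hab => by
      obtain ⟨g, rfl⟩ := MulAction.orbitRel_apply.1 hab
      exact MulAction.orbitRel_apply.2 ⟨g, (hφ' g b).symm⟩
    left_inv := fun a => Quotient.inductionOn' a fun x => by
      show Quotient.mk'' (φ.symm (φ x)) = Quotient.mk'' x
      rw [RelIso.symm_apply_apply]
    right_inv := fun a => Quotient.inductionOn' a fun x => by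
      show Quotient.mk'' (φ (φ.symm x)) = Quotient.mk'' x
      rw [RelIso.apply_symm_apply]
    map_rel_iff' := by
      intro a b
      induction a using Quotient.inductionOn' with
      | h x =>
      induction b using Quotient.inductionOn' with
      | h y =>
      show (orbitQuotientGraph G Γ).Adj (qmk Γ (φ x)) (qmk Γ (φ y)) ↔
        (orbitQuotientGraph G Γ).Adj (qmk Γ x) (qmk Γ y)
      rw [quot_adj_iff hact, quot_adj_iff hact]
      refine and_congr (not_congr ?_) ⟨?_, ?_⟩
      · rw [qmk_eq_iff, qmk_eq_iff]
        constructor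
        · rintro ⟨g, hg⟩
          exact ⟨g, φ.injective (by rw [hφ, hg])⟩
        · rintro ⟨g, hg⟩
          exact ⟨g, by rw [← hφ, hg]⟩
      · rintro ⟨g, hg⟩
        exact ⟨g, by rwa [← hφ, φ.map_rel_iff] at hg⟩
      · rintro ⟨g, hg⟩
        exact ⟨g, by rwa [← hφ, φ.map_rel_iff]⟩ }

/-- `quotIsoOfEquivariant` on an orbit. [folklore] -/
theorem quotIsoOfEquivariant_apply {V : Type*} {G : SimpleGraph V} {Γ : Type*} [Group Γ]
    [MulAction Γ V] (hact : IsActionByAut G Γ) (φ : G ≃g G)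
    (hφ : ∀ (g : Γ) (x : V), φ (g • x) = g • φ x) (x : V) :
    quotIsoOfEquivariant hact φ hφ (qmk Γ x) = qmk Γ (φ x) := rfl

/-- The central quotient `⟨C^M⟩ \ Cay(H₃(ℤ) × ℤ)` is (quasi-)transitive: left translations descend. [folklore] -/
theorem centralQuotient_quasiTransitive (M : ℕ) :
    IsQuasiTransitive (orbitQuotientGraph heisenbergZGraph (CentralShift M)) := by
  classical
  refine ⟨{qmk (CentralShift M) 0}, fun u => ?_⟩
  induction u using Quotient.inductionOn' with
  | h v =>
  refine ⟨quotIsoOfEquivariant (centralShift_isActionByAut M) (hzLeftIso (hzInv v))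
    (fun g x => hzMul_smul g (hzInv v) x), ?_⟩
  rw [Finset.mem_singleton]
  show qmk (CentralShift M) (hzMul (hzInv v) v) = qmk (CentralShift M) 0
  rw [hzInv_mul]

/-- **Martineau–Severo for the central quotient**: `p_c(G) < p_c(⟨C^M⟩ \ G)` at the image of the root,
for every `M ≥ 1`. [cite: MartineauSevero2019, Cor. 2.2] -/
theorem criticalProb_lt_criticalProb_centralQuotient {M : ℕ} (hM : M ≠ 0) :
    criticalProb heisenbergZGraph 0 <
      criticalProb (orbitQuotientGraph heisenbergZGraph (CentralShift M)) (qmk (CentralShift M) 0) :=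
  MartineauSevero2019_cor22_holds HZ heisenbergZGraph (CentralShift M) inferInstance
    (centralShift_isActionByAut M) (centralShift_free hM) heisenbergZGraph_connected
    heisenbergZGraph_quasiTransitive (centralQuotient_quasiTransitive M) 0 criticalProb_heisenbergZ_lt_one

/-! ### The slab `S_r` embeds into the central quotient for `M > 2r² + r` -/

/-- Across an edge of `G` the slab coordinate `c − ab` changes by at most `|b|`: `·A` changes it by `∓b`
(and keeps `b`), `·B` and `·T` leave it unchanged. [folklore] -/
theorem abs_slabCoord_sub_le {x y : HZ} (h : heisenbergZGraph.Adj x y) :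
    |(y 2 - y 0 * y 1) - (x 2 - x 0 * x 1)| ≤ |x 1| := by
  rw [heisenbergZGraph_adj] at h
  obtain ⟨-, (h | h | h) | (h | h | h)⟩ := h
  · subst h
    have e : (hzMul x gA 2 - hzMul x gA 0 * hzMul x gA 1) - (x 2 - x 0 * x 1) = -x 1 := by
      simp [hzMul, gA]; ring
    rw [e, abs_neg]
  · subst h
    have e : (hzMul x gB 2 - hzMul x gB 0 * hzMul x gB 1) - (x 2 - x 0 * x 1) = 0 := by
      simp [hzMul, gB]; ring
    rw [e, abs_zero]; exact abs_nonneg _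
  · subst h
    have e : (hzMul x gT 2 - hzMul x gT 0 * hzMul x gT 1) - (x 2 - x 0 * x 1) = 0 := by
      simp [hzMul, gT]
    rw [e, abs_zero]; exact abs_nonneg _
  · subst h
    have e : (y 2 - y 0 * y 1) - (hzMul y gA 2 - hzMul y gA 0 * hzMul y gA 1) = hzMul y gA 1 := by
      simp [hzMul, gA]; ring
    rw [e]
  · subst h
    have e : (y 2 - y 0 * y 1) - (hzMul y gB 2 - hzMul y gB 0 * hzMul y gB 1) = 0 := by
      simp [hzMul, gB]; ring
    rw [e, abs_zero]; exact abs_nonneg _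
  · subst h
    have e : (y 2 - y 0 * y 1) - (hzMul y gT 2 - hzMul y gT 0 * hzMul y gT 1) = 0 := by
      simp [hzMul, gT]
    rw [e, abs_zero]; exact abs_nonneg _

/-- Two points of `S_r` in the same `Γ_M`-orbit coincide once `M > 2r²`. [folklore] -/
theorem eq_of_smul_mem_hzSlab {M r : ℕ} (hM : 2 * r ^ 2 < M) {g : CentralShift M} {x : HZ}
    (hx : x ∈ hzSlab r) (hgx : g • x ∈ hzSlab r) : g = 1 := by
  have h1 := hx.2
  have h2 := hgx.2
  rw [CentralShift.smul_def] at h2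
  simp only [Matrix.cons_val_zero, Matrix.cons_val_one, Matrix.cons_val] at h2
  -- `|(c−ab) + M e| ≤ r²` and `|c − ab| ≤ r²` force `e = 0`
  have hb : |(M : ℤ) * g.exp| ≤ 2 * (r : ℤ) ^ 2 := by
    have e : x 2 + ↑M * g.exp - x 0 * x 1 - (x 2 - x 0 * x 1) = ↑M * g.exp := by ring
    calc |(M : ℤ) * g.exp| = |x 2 + ↑M * g.exp - x 0 * x 1 - (x 2 - x 0 * x 1)| := by rw [e]
      _ ≤ |x 2 + ↑M * g.exp - x 0 * x 1| + |x 2 - x 0 * x 1| := abs_sub _ _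
      _ ≤ (r : ℤ) ^ 2 + (r : ℤ) ^ 2 := add_le_add h2 h1
      _ = 2 * (r : ℤ) ^ 2 := by ring
  have hexp : g.exp = 0 := by
    by_contra hne
    have h1le : 1 ≤ |g.exp| := Int.one_le_abs hne
    have hM' : (2 * r ^ 2 : ℤ) < M := by exact_mod_cast hM
    have : (M : ℤ) ≤ |(M : ℤ) * g.exp| := by
      rw [abs_mul, Nat.abs_cast]
      exact le_mul_of_one_le_right (by positivity) h1le
    linarith
  exact CentralShift.exp_injective (by simpa using hexp)

/-- A point of `S_r` adjacent to a `Γ_M`-translate of a point of `S_r` is adjacent to the point itself,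
once `M > 2r² + r`. [folklore] -/
theorem eq_one_of_adj_smul {M r : ℕ} (hM : 2 * r ^ 2 + r < M) {g : CentralShift M} {x y : HZ}
    (hx : x ∈ hzSlab r) (hy : y ∈ hzSlab r) (h : heisenbergZGraph.Adj x (g • y)) : g = 1 := by
  have hxb := hx.1
  have hxc := hx.2
  have hyc := hy.2
  have hd := abs_slabCoord_sub_le h
  rw [CentralShift.smul_def] at hd
  simp only [Matrix.cons_val_zero, Matrix.cons_val_one, Matrix.cons_val] at hd
  have e : y 2 + ↑M * g.exp - y 0 * y 1 - (x 2 - x 0 * x 1) =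
      ↑M * g.exp + ((y 2 - y 0 * y 1) - (x 2 - x 0 * x 1)) := by ring
  rw [e] at hd
  have hb : |(M : ℤ) * g.exp| ≤ 2 * (r : ℤ) ^ 2 + r := by
    set D : ℤ := (y 2 - y 0 * y 1) - (x 2 - x 0 * x 1) with hD
    have h3 : |D| ≤ (r : ℤ) ^ 2 + (r : ℤ) ^ 2 := (abs_sub _ _).trans (add_le_add hyc hxc)
    have e2 : (M : ℤ) * g.exp = (↑M * g.exp + D) - D := by ring
    calc |(M : ℤ) * g.exp| = |(↑M * g.exp + D) - D| := by rw [← e2]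
      _ ≤ |↑M * g.exp + D| + |D| := abs_sub _ _
      _ ≤ (r : ℤ) + ((r : ℤ) ^ 2 + (r : ℤ) ^ 2) := add_le_add (hd.trans hxb) h3
      _ = 2 * (r : ℤ) ^ 2 + r := by ring
  have hexp : g.exp = 0 := by
    by_contra hne
    have h1le : 1 ≤ |g.exp| := Int.one_le_abs hne
    have hM' : (2 * r ^ 2 + r : ℤ) < M := by exact_mod_cast hM
    have : (M : ℤ) ≤ |(M : ℤ) * g.exp| := by
      rw [abs_mul, Nat.abs_cast]
      exact le_mul_of_one_le_right (by positivity) h1le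
    linarith
  exact CentralShift.exp_injective (by simpa using hexp)

/-- The slab-to-quotient map `x ↦ Γ_M x`. [folklore] -/
def slabToQuot (M r : ℕ) (x : hzSlab r) : MulAction.orbitRel.Quotient (CentralShift M) HZ :=
  qmk (CentralShift M) x.1

/-- It is injective for `M > 2r²`. [folklore] -/
theorem slabToQuot_injective {M r : ℕ} (hM : 2 * r ^ 2 < M) : Function.Injective (slabToQuot M r) := by
  intro x y h
  obtain ⟨g, hg⟩ := (qmk_eq_iff (CentralShift M) x.1 y.1).1 h
  have hgy : g • y.1 ∈ hzSlab r := by rw [hg]; exact x.2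
  have hg1 : g = 1 := eq_of_smul_mem_hzSlab hM y.2 hgy
  apply Subtype.ext
  rw [← hg, hg1, one_smul]

/-- **`G[S_r]` is exactly the pull-back of the central quotient graph along `x ↦ Γ_M x`** (`M > 2r² + r`):
no new adjacency is created by the quotient between points of the slab (pattern
`induce_symSlab_eq_comap` of `L/QuotientStrictMonotonicity.lean`). [folklore] -/
theorem hzSlabGraph_eq_comap {M r : ℕ} (hM : 2 * r ^ 2 + r < M) :
    hzSlabGraph r = (orbitQuotientGraph heisenbergZGraph (CentralShift M)).comap (slabToQuot M r) := by
  ext x y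
  rw [SimpleGraph.comap_adj]
  show heisenbergZGraph.Adj x.1 y.1 ↔ (orbitQuotientGraph heisenbergZGraph (CentralShift M)).Adj
    (qmk (CentralShift M) x.1) (qmk (CentralShift M) y.1)
  rw [quot_adj_iff (centralShift_isActionByAut M)]
  constructor
  · intro h
    refine ⟨fun heq => ?_, ⟨1, by rwa [one_smul]⟩⟩
    have hM' : 2 * r ^ 2 < M := lt_of_le_of_lt (Nat.le_add_right _ _) hM
    obtain ⟨g, hg⟩ := (qmk_eq_iff (CentralShift M) x.1 y.1).1 heq
    have hgy : g • y.1 ∈ hzSlab r := by rw [hg]; exact x.2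
    have hg1 : g = 1 := eq_of_smul_mem_hzSlab hM' y.2 hgy
    rw [hg1, one_smul] at hg
    exact h.ne hg.symm
  · rintro ⟨-, g, hg⟩
    have hg1 : g = 1 := eq_one_of_adj_smul hM x.2 y.2 hg
    rwa [hg1, one_smul] at hg

/-- `θ_{S_r}(0,p) ≤ θ_{⟨C^M⟩\G}(Γ_M 0, p)` for `M > 2r² + r` (restriction coupling through the comap).
[folklore] -/
theorem theta_hzSlab_le_theta_quot {M r : ℕ} (hM : 2 * r ^ 2 + r < M) (p : unitInterval) :
    theta (hzSlabGraph r) (hzSlabOrigin r) p ≤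
      theta (orbitQuotientGraph heisenbergZGraph (CentralShift M)) (qmk (CentralShift M) 0) p := by
  haveI : Countable (MulAction.orbitRel.Quotient (CentralShift M) HZ) :=
    inferInstanceAs (Countable (Quotient (MulAction.orbitRel (CentralShift M) HZ)))
  have hM' : 2 * r ^ 2 < M := lt_of_le_of_lt (Nat.le_add_right _ _) hM
  rw [hzSlabGraph_eq_comap hM]
  exact theta_comap_le (orbitQuotientGraph heisenbergZGraph (CentralShift M)) (slabToQuot_injective hM')
    (hzSlabOrigin r) p

/-- **(D5′) for `H₃(ℤ) × ℤ`: every slab `S_r` is strictly subcritical at `p_c(G)`**, `p_c(G) < p_c(S_r)`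
(Martineau–Severo central quotient with `M = 2r² + r + 1`). [cite: MartineauSevero2019, Cor. 2.2] -/
theorem heisenbergZSlabStrictSubcritical_holds : HeisenbergZSlabStrictSubcritical := by
  intro r
  set M : ℕ := 2 * r ^ 2 + r + 1 with hMdef
  have hM : 2 * r ^ 2 + r < M := by omega
  have hM0 : M ≠ 0 := by omega
  calc criticalProb heisenbergZGraph 0
      < criticalProb (orbitQuotientGraph heisenbergZGraph (CentralShift M)) (qmk (CentralShift M) 0) :=
        criticalProb_lt_criticalProb_centralQuotient hM0
    _ ≤ criticalProb (hzSlabGraph r) (hzSlabOrigin r) :=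
        criticalProb_le_of_theta_le _ _ _ _ (theta_hzSlab_le_theta_quot hM)

/-- **(D5) for `H₃(ℤ) × ℤ`: no slab `S_r` percolates at `p_c(G)`.** [cite: MartineauSevero2019, Cor. 2.2] -/
theorem heisenbergZSlabCritical_holds : HeisenbergZSlabCritical :=
  slabCritical_of_strict heisenbergZSlabStrictSubcritical_holds

/-- Hence on this rung the conjunct is EXACTLY the same-`p` slab statement: `(D1–D4) ⟹ θ_G(p_c(G)) = 0`.
[cite: KozmaNitzan2024, Thm. 6] -/
theorem continuity_of_slabPercolation (hslab : HeisenbergZSlabPercolation) : HeisenbergZCriticalContinuity :=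
  continuity_of_slabPercolation_of_slabCritical hslab heisenbergZSlabCritical_holds

end CentralQuotient

end Summit.CriticalPhenomena.PercolationContinuityZ3.Theorems.HeisenbergZ
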